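import Summits.Ventures.DiscreteObjects.UnitDistance.FieldPlanes
import HarnessLib

/-!
# Forced pairs in a finite gadget transport along `K`-rational isometries — cell `pub-namedobj`, target (U), seat udg g22

Framing (verbatim for the cell): lottery ticket; floor = certified bounds/negative ranges.

The constructive line of THEORY-U22 §5: a FINITE unit-distance configuration `S ⊂ K²` (a 'gadget') in which a pair `P, Q` is
FORCED — equal in every proper `4`-colouring, or different in every proper `4`-colouring — is moved around by the isometries
`v ↦ p + R (v − P)` whose rotation part `R = ((α, −β), (β, α))` has entries in `K`; such maps send `K²` to `K²` and unit distances
to unit distances, so a `4`-colouring of `K²` restricts to a proper colouring of every copy.  Two consequences, both elementary: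

* `pairs_ne_of_forced_ne` — if `(P, Q)` is forced DIFFERENT in `S`, then EVERY pair `p, q ∈ K²` with `dist p q = dist P Q` is
  bichromatic in every proper `4`-colouring of `K²` (the rotation taking `Q − P` to `q − p` has `α = ⟨u,w⟩/d²`, `β = det(u,w)/d²`,
  both in `K`).  For `dist P Q = √3` and `√3, √5 ∈ K` this is exactly the hypothesis of udg g21's
  `not_colorable_four_plane_of_sqrt3_pairs_bichromatic` (`Sqrt3PairReduction.lean`), i.e. ONE Haugland gadget over `K` gives `χ(K²) = 5`.
* `not_colorable_four_of_forced_eq` — if `(P, Q)` is forced EQUAL in `S` and `K²` contains a point `Y` with `dist P Y = dist P Q` and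
  `dist Q Y = 1` (i.e. `4·dist(P,Q)² − 1` is a square in `K`: the 'spindle-admissible' distances `1/4, 1/2, 3/2, 4, 2 ± √3, 7/3, 5/2, …` of
  FAMILIES-U22 #9), then `K²` is NOT `4`-colourable: the rotation about `P` taking `Q` to `Y` gives `C Q = C P = C Y` with `Q ~ Y`.

Nothing here is specific to `ℚ(√3,√5)`; `K` is any subfield of `ℝ`.  Ours; elementary; nothing is cited as a fact.  The gadgets themselves
(forced pairs in the rigid 1,795-vertex block of the cell) are computational candidates, NOT claimed here.
-/

noncomputable section

namespace Summit.Ventures.DiscreteObjects.UnitDistance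

open SimpleGraph

namespace ForcedPair

/-- The plane. -/
abbrev Pt := EuclideanSpace ℝ (Fin 2)

/-- The affine map `v ↦ p + R (v − P)` with rotation part `R = ((α, −β), (β, α))`. -/
def rotMove (P p : Pt) (α β : ℝ) (v : Pt) : Pt :=
  !₂[p 0 + (α * (v 0 - P 0) - β * (v 1 - P 1)), p 1 + (β * (v 0 - P 0) + α * (v 1 - P 1))]

/-- Squared distance in coordinates. -/
theorem dist_sq (v w : Pt) : dist v w ^ 2 = (v 0 - w 0) ^ 2 + (v 1 - w 1) ^ 2 := by
  rw [EuclideanSpace.dist_sq_eq, Fin.sum_univ_two, Real.dist_eq, Real.dist_eq, sq_abs, sq_abs]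

/-- Coordinates of `rotMove`. -/
theorem rotMove_apply_zero (P p : Pt) (α β : ℝ) (v : Pt) :
    rotMove P p α β v 0 = p 0 + (α * (v 0 - P 0) - β * (v 1 - P 1)) := by
  simp [rotMove]

/-- Coordinates of `rotMove`. -/
theorem rotMove_apply_one (P p : Pt) (α β : ℝ) (v : Pt) :
    rotMove P p α β v 1 = p 1 + (β * (v 0 - P 0) + α * (v 1 - P 1)) := by
  simp [rotMove]

/-- `rotMove` with `α² + β² = 1` is an isometry. -/
theorem dist_rotMove (P p : Pt) {α β : ℝ} (h : α ^ 2 + β ^ 2 = 1) (v w : Pt) :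
    dist (rotMove P p α β v) (rotMove P p α β w) = dist v w := by
  have h1 : dist (rotMove P p α β v) (rotMove P p α β w) ^ 2 = dist v w ^ 2 := by
    rw [dist_sq, dist_sq, rotMove_apply_zero, rotMove_apply_zero, rotMove_apply_one, rotMove_apply_one]
    linear_combination ((v 0 - w 0) ^ 2 + (v 1 - w 1) ^ 2) * h
  have := (abs_eq_abs.mpr (Or.inl rfl) : |dist v w| = |dist v w|)
  nlinarith [dist_nonneg (x := rotMove P p α β v) (y := rotMove P p α β w), dist_nonneg (x := v) (y := w),
    sq_nonneg (dist (rotMove P p α β v) (rotMove P p α β w) - dist v w),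
    sq_nonneg (dist (rotMove P p α β v) (rotMove P p α β w) + dist v w)]

/-- `rotMove` maps the base point `P` to `p`. -/
theorem rotMove_base (P p : Pt) (α β : ℝ) : rotMove P p α β P = p := by
  ext i; fin_cases i <;> simp [rotMove]

/-- `rotMove` with coefficients in `K` maps `K²` to `K²`. -/
theorem rotMove_mem {K : IntermediateField ℚ ℝ} {P p : Pt} {α β : ℝ} (hα : α ∈ K) (hβ : β ∈ K)
    (hP : P ∈ fieldPoints K) (hp : p ∈ fieldPoints K) {v : Pt} (hv : v ∈ fieldPoints K) :
    rotMove P p α β v ∈ fieldPoints K := by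
  intro i
  fin_cases i
  · show rotMove P p α β v 0 ∈ K
    rw [rotMove_apply_zero]
    exact add_mem (hp 0) (sub_mem (mul_mem hα (sub_mem (hv 0) (hP 0))) (mul_mem hβ (sub_mem (hv 1) (hP 1))))
  · show rotMove P p α β v 1 ∈ K
    rw [rotMove_apply_one]
    exact add_mem (hp 1) (add_mem (mul_mem hβ (sub_mem (hv 0) (hP 0))) (mul_mem hα (sub_mem (hv 1) (hP 1))))

/-- THE `K`-RATIONAL ROTATION between two pairs at the same (nonzero) distance: with `u = Q − P`, `w = q − p`,
`α = ⟨u, w⟩ / d²`, `β = det(u, w) / d²` (`d = dist P Q = dist p q`) one has `α² + β² = 1` and `rotMove P p α β Q = q`. -/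
def alphaOf (P Q p q : Pt) : ℝ := ((Q 0 - P 0) * (q 0 - p 0) + (Q 1 - P 1) * (q 1 - p 1)) / dist P Q ^ 2
/-- see `alphaOf` -/
def betaOf (P Q p q : Pt) : ℝ := ((Q 0 - P 0) * (q 1 - p 1) - (Q 1 - P 1) * (q 0 - p 0)) / dist P Q ^ 2

/-- `α² + β² = 1` (Lagrange's identity `⟨u,w⟩² + det(u,w)² = |u|²|w|²`). -/
theorem alpha_sq_add_beta_sq {P Q p q : Pt} (hPQ : P ≠ Q) (hd : dist p q = dist P Q) :
    alphaOf P Q p q ^ 2 + betaOf P Q p q ^ 2 = 1 := by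
  have hd0 : dist P Q ≠ 0 := dist_ne_zero.mpr hPQ
  have hd2 : dist P Q ^ 2 ≠ 0 := pow_ne_zero 2 hd0
  have e1 : dist P Q ^ 2 = (Q 0 - P 0) ^ 2 + (Q 1 - P 1) ^ 2 := by rw [dist_comm, dist_sq]
  have e2 : dist P Q ^ 2 = (q 0 - p 0) ^ 2 + (q 1 - p 1) ^ 2 := by rw [← hd, dist_comm, dist_sq]
  unfold alphaOf betaOf
  rw [div_pow, div_pow, ← add_div, div_eq_one_iff_eq (pow_ne_zero 2 hd2)]
  have : (dist P Q ^ 2) ^ 2 = ((Q 0 - P 0) ^ 2 + (Q 1 - P 1) ^ 2) * ((q 0 - p 0) ^ 2 + (q 1 - p 1) ^ 2) := by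
    rw [sq (dist P Q ^ 2)]; nth_rewrite 1 [e1]; rw [e2]
  rw [this]; ring

/-- The map takes `Q` to `q` (for any `q`; it is an isometry when `dist p q = dist P Q`, `alpha_sq_add_beta_sq`). -/
theorem rotMove_apply_Q {P Q p q : Pt} (hPQ : P ≠ Q) :
    rotMove P p (alphaOf P Q p q) (betaOf P Q p q) Q = q := by
  have hd0 : dist P Q ≠ 0 := dist_ne_zero.mpr hPQ
  have hd2 : dist P Q ^ 2 ≠ 0 := pow_ne_zero 2 hd0
  have e1 : dist P Q ^ 2 = (Q 0 - P 0) ^ 2 + (Q 1 - P 1) ^ 2 := by rw [dist_comm, dist_sq]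
  have hx : alphaOf P Q p q * (Q 0 - P 0) - betaOf P Q p q * (Q 1 - P 1) = q 0 - p 0 := by
    unfold alphaOf betaOf
    rw [div_mul_eq_mul_div, div_mul_eq_mul_div, ← sub_div, div_eq_iff hd2]
    linear_combination (-(q 0 - p 0)) * e1
  have hy : betaOf P Q p q * (Q 0 - P 0) + alphaOf P Q p q * (Q 1 - P 1) = q 1 - p 1 := by
    unfold alphaOf betaOf
    rw [div_mul_eq_mul_div, div_mul_eq_mul_div, ← add_div, div_eq_iff hd2]
    linear_combination (-(q 1 - p 1)) * e1
  ext i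
  fin_cases i
  · show rotMove P p (alphaOf P Q p q) (betaOf P Q p q) Q 0 = q 0
    rw [rotMove_apply_zero]; linear_combination hx
  · show rotMove P p (alphaOf P Q p q) (betaOf P Q p q) Q 1 = q 1
    rw [rotMove_apply_one]; linear_combination hy

/-- The coefficients are in `K` when all four points are in `K²`. -/
theorem alphaOf_mem {K : IntermediateField ℚ ℝ} {P Q p q : Pt} (hP : P ∈ fieldPoints K) (hQ : Q ∈ fieldPoints K)
    (hp : p ∈ fieldPoints K) (hq : q ∈ fieldPoints K) : alphaOf P Q p q ∈ K ∧ betaOf P Q p q ∈ K := by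
  have hd : dist P Q ^ 2 ∈ K := by
    rw [dist_sq]; exact add_mem (pow_mem (sub_mem (hP 0) (hQ 0)) 2) (pow_mem (sub_mem (hP 1) (hQ 1)) 2)
  refine ⟨div_mem ?_ hd, div_mem ?_ hd⟩
  · exact add_mem (mul_mem (sub_mem (hQ 0) (hP 0)) (sub_mem (hq 0) (hp 0))) (mul_mem (sub_mem (hQ 1) (hP 1)) (sub_mem (hq 1) (hp 1)))
  · exact sub_mem (mul_mem (sub_mem (hQ 0) (hP 0)) (sub_mem (hq 1) (hp 1))) (mul_mem (sub_mem (hQ 1) (hP 1)) (sub_mem (hq 0) (hp 0)))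

/-- TRANSPORT: a proper `4`-colouring of `K²` pulled back along a `K`-rational isometry `g = rotMove P p α β` is a proper colouring of
any configuration `S ⊆ K²`. -/
def pullback {K : IntermediateField ℚ ℝ} (C : (planeUnitDistanceGraph.induce (fieldPoints K)).Coloring (Fin 4))
    (S : Set Pt) (hS : S ⊆ fieldPoints K) {P p : Pt} {α β : ℝ} (hα : α ∈ K) (hβ : β ∈ K) (hαβ : α ^ 2 + β ^ 2 = 1)
    (hP : P ∈ fieldPoints K) (hp : p ∈ fieldPoints K) : (planeUnitDistanceGraph.induce S).Coloring (Fin 4) :=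
  Coloring.mk (fun v => C ⟨rotMove P p α β v, rotMove_mem hα hβ hP hp (hS v.2)⟩) fun {v w} hvw => by
    apply C.valid
    show dist (rotMove P p α β v) (rotMove P p α β w) = 1
    rw [dist_rotMove P p hαβ]
    exact hvw

/-- Value of the pulled-back colouring. -/
theorem pullback_apply {K : IntermediateField ℚ ℝ} (C : (planeUnitDistanceGraph.induce (fieldPoints K)).Coloring (Fin 4))
    (S : Set Pt) (hS : S ⊆ fieldPoints K) {P p : Pt} {α β : ℝ} (hα : α ∈ K) (hβ : β ∈ K) (hαβ : α ^ 2 + β ^ 2 = 1)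
    (hP : P ∈ fieldPoints K) (hp : p ∈ fieldPoints K) (v : S) :
    pullback C S hS hα hβ hαβ hP hp v = C ⟨rotMove P p α β v, rotMove_mem hα hβ hP hp (hS v.2)⟩ := rfl

end ForcedPair

open ForcedPair

/-- FORCED-DIFFERENT PAIRS TRANSPORT.  If a configuration `S ⊆ K²` contains `P ≠ Q` with `C' P ≠ C' Q` for EVERY proper `4`-colouring
`C'` of `S`, then every pair `p, q ∈ K²` at the same distance is bichromatic in every proper `4`-colouring of `K²`.  (With
`dist P Q = √3`, `√3, √5 ∈ K`: the hypothesis of `not_colorable_four_plane_of_sqrt3_pairs_bichromatic` — one Haugland gadget over `K`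
gives `χ(K²) = 5`.) -/
theorem pairs_ne_of_forced_ne (K : IntermediateField ℚ ℝ) (S : Set Pt) (hS : S ⊆ fieldPoints K) {P Q : Pt} (hPS : P ∈ S)
    (hQS : Q ∈ S) (hPQ : P ≠ Q)
    (hforced : ∀ C' : (planeUnitDistanceGraph.induce S).Coloring (Fin 4), C' ⟨P, hPS⟩ ≠ C' ⟨Q, hQS⟩)
    (C : (planeUnitDistanceGraph.induce (fieldPoints K)).Coloring (Fin 4)) (p q : fieldPoints K)
    (hd : dist (p : Pt) q = dist P Q) : C p ≠ C q := by
  obtain ⟨hα, hβ⟩ := alphaOf_mem (hS hPS) (hS hQS) p.2 q.2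
  have hαβ := alpha_sq_add_beta_sq hPQ hd
  have h := hforced (pullback C S hS hα hβ hαβ (hS hPS) p.2)
  rw [pullback_apply, pullback_apply] at h
  have e1 : (⟨rotMove P p (alphaOf P Q p q) (betaOf P Q p q) P, rotMove_mem hα hβ (hS hPS) p.2 (hS hPS)⟩ : fieldPoints K) = p :=
    Subtype.ext (rotMove_base P p _ _)
  have e2 : (⟨rotMove P p (alphaOf P Q p q) (betaOf P Q p q) Q, rotMove_mem hα hβ (hS hPS) p.2 (hS hQS)⟩ : fieldPoints K) = q :=
    Subtype.ext (rotMove_apply_Q hPQ)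
  rwa [e1, e2] at h

/-- FORCED-EQUAL PAIR + SPINDLE.  If a configuration `S ⊆ K²` contains `P, Q` with `C' P = C' Q` for every proper `4`-colouring `C'`
of `S`, and `K²` contains a point `Y` with `dist P Y = dist P Q` and `dist Q Y = 1` (equivalently `4·dist(P,Q)² − 1` is a square in
`K`), then `K²` is not `4`-colourable: rotating `S` about `P` so that `Q ↦ Y` forces `C Q = C P = C Y` for the adjacent `Q, Y`. -/
theorem not_colorable_four_of_forced_eq (K : IntermediateField ℚ ℝ) (S : Set Pt) (hS : S ⊆ fieldPoints K) {P Q : Pt}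
    (hPS : P ∈ S) (hQS : Q ∈ S) (hPQ : P ≠ Q)
    (hforced : ∀ C' : (planeUnitDistanceGraph.induce S).Coloring (Fin 4), C' ⟨P, hPS⟩ = C' ⟨Q, hQS⟩)
    {Y : Pt} (hY : Y ∈ fieldPoints K) (hPY : dist P Y = dist P Q) (hQY : dist Q Y = 1) :
    ¬ (planeUnitDistanceGraph.induce (fieldPoints K)).Colorable 4 := by
  rintro ⟨C⟩
  obtain ⟨hα, hβ⟩ := alphaOf_mem (hS hPS) (hS hQS) (hS hPS) hY
  have hαβ := alpha_sq_add_beta_sq hPQ hPY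
  -- the copy rotated about P with Q ↦ Y
  have h1 := hforced (pullback C S hS hα hβ hαβ (hS hPS) (hS hPS))
  rw [pullback_apply, pullback_apply] at h1
  have e1 : (⟨rotMove P P (alphaOf P Q P Y) (betaOf P Q P Y) P, rotMove_mem hα hβ (hS hPS) (hS hPS) (hS hPS)⟩ : fieldPoints K)
      = ⟨P, hS hPS⟩ := Subtype.ext (rotMove_base P P _ _)
  have e2 : (⟨rotMove P P (alphaOf P Q P Y) (betaOf P Q P Y) Q, rotMove_mem hα hβ (hS hPS) (hS hPS) (hS hQS)⟩ : fieldPoints K)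
      = ⟨Y, hY⟩ := Subtype.ext (rotMove_apply_Q hPQ)
  rw [e1, e2] at h1
  -- the original copy (α = 1, β = 0 is not needed: use hforced on the restriction of C itself, i.e. the pullback along the identity rotation)
  have hone : (1 : ℝ) ∈ K := one_mem K
  have hzero : (0 : ℝ) ∈ K := zero_mem K
  have h10 : (1 : ℝ) ^ 2 + (0 : ℝ) ^ 2 = 1 := by norm_num
  have h0 := hforced (pullback C S hS hone hzero h10 (hS hPS) (hS hPS))
  rw [pullback_apply, pullback_apply] at h0
  have id_apply : ∀ v : Pt, rotMove P P 1 0 v = v := by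
    intro v; ext i; fin_cases i <;> simp [rotMove]
  have e3 : (⟨rotMove P P 1 0 P, rotMove_mem hone hzero (hS hPS) (hS hPS) (hS hPS)⟩ : fieldPoints K) = ⟨P, hS hPS⟩ :=
    Subtype.ext (id_apply P)
  have e4 : (⟨rotMove P P 1 0 Q, rotMove_mem hone hzero (hS hPS) (hS hPS) (hS hQS)⟩ : fieldPoints K) = ⟨Q, hS hQS⟩ :=
    Subtype.ext (id_apply Q)
  rw [e3, e4] at h0
  -- now C P = C Q and C P = C Y, but Q ~ Y
  have hadj : (planeUnitDistanceGraph.induce (fieldPoints K)).Adj ⟨Q, hS hQS⟩ ⟨Y, hY⟩ := by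
    show dist Q Y = 1
    exact hQY
  exact C.valid hadj (h0.symm.trans h1)

end Summit.Ventures.DiscreteObjects.UnitDistance
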